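import Literature.NumberTheory.LFunctions.YoshidaWindowGramTailJFactoredScaled
import HarnessLib

/-!
# Kernel enclosures of Yoshida's matrix coefficients — XI-a: the COMPRESSED EXACT MIDDLE (design "MJ") as real functions,
structured and FACTORED forms

Source: H. Yoshida, Adv. Stud. Pure Math. **21** (1992) 281–325, §§6–7 [Yoshida1992HermitianForms].

Between the exact columns `[B, B₃)` and the analytic tail the format-C certificate may use a COMPRESSED MIDDLE `[B₃, B₄)`
(rh-explicit weil-10, `Summits/…/WeilFormatCMiddleEvenJ.lean` / `…MiddleOddJ.lean`: `even/odd_middleJ_majorant_matrix`,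
whose conclusion is the `hUmid` premise of `WeilFormatC.weilPositivityOn_of_formatC_piecesA`): per sector the bound is the
quadratic form of an explicit matrix built from the `(2J)×(2J)` Gram blocks of the exact column profiles
`F_m/(π m^{2j+1})`, `m^{−(2r+2)}` (finite sums over the middle range with per-mode weights `w`) against the row functionals
`v^A`, `v^B` of the order-`J` expansion (part VII-a), plus a diagonal remainder.  This file gives

* `Encl.UmidEvenJ` / `Encl.UmidOddJ` — the door's inline matrices VERBATIM as real functions of `ℕ` indices (written by
  weil-10's generator from the same templates as the theorems), with the `Fin` bridges `UmidEvenJ_fin` / `UmidOddJ_fin`;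
* the Gram blocks `hmAAe/hmABe/hmBAe/hmBBe`, `smidE` (odd: `…o`) and the structured forms `UmidEvenJ'`/`UmidOddJ'`
  (`= UmidEvenJ`/`UmidOddJ` by unfolding);
* the FACTORED form for the column-band kit (part IX; `Summits/…/WeilFormatCDataKitCB.lean`): with the order-`J` left
  factors `phiJe`/`phiJo` of part VII-d, `UmidEvenJ i i' = Σ_{r<2J} phiJe(i,r)·psiMidE(i',r) + [i=i']·dMidE(i)`
  (`UmidEvenJ_eq_factored`), the rescaled variant with `phiJeS = φ/B^{p(r)}`, `psiMidES = ψ·B^{p(r)}`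
  (`UmidEvenJ_eq_factoredS`), symmetry `UmidEvenJ_comm`; odd alike.

Boxes of the new atoms are part XI-b (`YoshidaWindowGramMiddleJBox`).  Everything is proved; no named facts.
-/

open Real Complex Finset Matrix
open scoped BigOperators

namespace Literature.NumberTheory.LFunctions.Yoshida1992

open Literature.Analysis.SpecialFunctions Literature.Analysis.ValidatedNumerics.NumericsMP
open Literature.Analysis.ValidatedNumerics
open scoped ArithmeticFunction.vonMangoldt

namespace Encl

variable {a : ℝ}

/-! ## The verbatim middle matrices (weil-10's templates) -/

/-- **Compressed exact middle, even sector** (`i, i' : ℕ`; `w` = per-mode column weights on `[B₃, B₄)`).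
[cite: Yoshida1992HermitianForms, §7 pp. 305–312] -/
noncomputable def UmidEvenJ (a θ : ℝ) (B B₃ B₄ J : ℕ) (w : ℕ → ℝ) (i i' : ℕ) : ℝ :=
  (1 + θ) * (((∑ j ∈ Finset.range J, ∑ j' ∈ Finset.range J, (∑ m ∈ Finset.Ico B₃ B₄, (((Complex.digamma (1 / 4 + ((freq a m : ℝ) : ℂ) / 2 * I)).im / 2 + (∑ k ∈ weilPrimeIndex a, (Λ k : ℝ) / Real.sqrt k * Real.sin (freq a m * Real.log k)) - archExpSumSin a m) / π / (m : ℝ) ^ (2 * j + 1)) * (((Complex.digamma (1 / 4 + ((freq a m : ℝ) : ℂ) / 2 * I)).im / 2 + (∑ k ∈ weilPrimeIndex a, (Λ k : ℝ) / Real.sqrt k * Real.sin (freq a m * Real.log k)) - archExpSumSin a m) / π / (m : ℝ) ^ (2 * j' + 1)) / w m) * ((-1 : ℝ) ^ i * (i : ℝ) ^ (2 * j)) * ((-1 : ℝ) ^ i' * (i' : ℝ) ^ (2 * j')))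
            + ∑ j ∈ Finset.range J, ∑ r' ∈ Finset.range J, (∑ m ∈ Finset.Ico B₃ B₄, (((Complex.digamma (1 / 4 + ((freq a m : ℝ) : ℂ) / 2 * I)).im / 2 + (∑ k ∈ weilPrimeIndex a, (Λ k : ℝ) / Real.sqrt k * Real.sin (freq a m * Real.log k)) - archExpSumSin a m) / π / (m : ℝ) ^ (2 * j + 1)) * (1 / (m : ℝ) ^ (2 * r' + 2)) / w m) * ((-1 : ℝ) ^ i * (i : ℝ) ^ (2 * j)) * ((-1 : ℝ) ^ i' * (-((i' : ℝ) ^ (2 * r' + 1)) * ((Complex.digamma (1 / 4 + ((freq a i' : ℝ) : ℂ) / 2 * I)).im / 2 + (∑ k ∈ weilPrimeIndex a, (Λ k : ℝ) / Real.sqrt k * Real.sin (freq a i' * Real.log k)) - archExpSumSin a i') / π + 4 / a * (Real.exp (a / 2) - Real.exp (-(a / 2))) ^ 2 * (-1 : ℝ) ^ r' * (a ^ 2 / (4 * π ^ 2)) ^ (r' + 1) * (1 / (1 + 4 * freq a i' ^ 2)))))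
          + ((∑ r' ∈ Finset.range J, ∑ j ∈ Finset.range J, (∑ m ∈ Finset.Ico B₃ B₄, (1 / (m : ℝ) ^ (2 * r' + 2)) * (((Complex.digamma (1 / 4 + ((freq a m : ℝ) : ℂ) / 2 * I)).im / 2 + (∑ k ∈ weilPrimeIndex a, (Λ k : ℝ) / Real.sqrt k * Real.sin (freq a m * Real.log k)) - archExpSumSin a m) / π / (m : ℝ) ^ (2 * j + 1)) / w m) * ((-1 : ℝ) ^ i * (-((i : ℝ) ^ (2 * r' + 1)) * ((Complex.digamma (1 / 4 + ((freq a i : ℝ) : ℂ) / 2 * I)).im / 2 + (∑ k ∈ weilPrimeIndex a, (Λ k : ℝ) / Real.sqrt k * Real.sin (freq a i * Real.log k)) - archExpSumSin a i) / π + 4 / a * (Real.exp (a / 2) - Real.exp (-(a / 2))) ^ 2 * (-1 : ℝ) ^ r' * (a ^ 2 / (4 * π ^ 2)) ^ (r' + 1) * (1 / (1 + 4 * freq a i ^ 2)))) * ((-1 : ℝ) ^ i' * (i' : ℝ) ^ (2 * j)))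
            + ∑ r' ∈ Finset.range J, ∑ r'' ∈ Finset.range J, (∑ m ∈ Finset.Ico B₃ B₄, (1 / (m : ℝ) ^ (2 * r' + 2)) * (1 / (m : ℝ) ^ (2 * r'' + 2)) / w m) * ((-1 : ℝ) ^ i * (-((i : ℝ) ^ (2 * r' + 1)) * ((Complex.digamma (1 / 4 + ((freq a i : ℝ) : ℂ) / 2 * I)).im / 2 + (∑ k ∈ weilPrimeIndex a, (Λ k : ℝ) / Real.sqrt k * Real.sin (freq a i * Real.log k)) - archExpSumSin a i) / π + 4 / a * (Real.exp (a / 2) - Real.exp (-(a / 2))) ^ 2 * (-1 : ℝ) ^ r' * (a ^ 2 / (4 * π ^ 2)) ^ (r' + 1) * (1 / (1 + 4 * freq a i ^ 2)))) * ((-1 : ℝ) ^ i' * (-((i' : ℝ) ^ (2 * r'' + 1)) * ((Complex.digamma (1 / 4 + ((freq a i' : ℝ) : ℂ) / 2 * I)).im / 2 + (∑ k ∈ weilPrimeIndex a, (Λ k : ℝ) / Real.sqrt k * Real.sin (freq a i' * Real.log k)) - archExpSumSin a i') / π + 4 / a * (Real.exp (a / 2) - Real.exp (-(a / 2))) ^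 2 * (-1 : ℝ) ^ r'' * (a ^ 2 / (4 * π ^ 2)) ^ (r'' + 1) * (1 / (1 + 4 * freq a i' ^ 2))))))
        + (if i = i' then (1 + θ⁻¹) * (B : ℝ) * ((2 * (π / 4 + (∑ k ∈ weilPrimeIndex a, (Λ k : ℝ) / Real.sqrt k) + a * (1 + weilArchDensity (2 * a)) / π) * (i : ℝ) ^ (2 * J) / π + 4 / a * (Real.exp (a / 2) - Real.exp (-(a / 2))) ^ 2 * (a ^ 2 / (4 * π ^ 2)) ^ (J + 1) * (1 / (1 + 4 * freq a i ^ 2)))) ^ 2 * (∑ m ∈ Finset.Ico B₃ B₄, (1 / ((m : ℝ) ^ (2 * J + 1))) ^ 2 / w m) else 0)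

/-- **Bridge**: the door's inline even middle matrix (indices in `Fin B`, sums over `Fin J`) is `UmidEvenJ`.
[cite: Yoshida1992HermitianForms, §7 pp. 305–312] -/
theorem UmidEvenJ_fin (a θ : ℝ) {B : ℕ} (B₃ B₄ J : ℕ) (w : ℕ → ℝ) (i i' : Fin B) :
    ((1 + θ) * (((∑ j : Fin J, ∑ j' : Fin J, (∑ m ∈ Finset.Ico B₃ B₄, (((Complex.digamma (1 / 4 + ((freq a m : ℝ) : ℂ) / 2 * I)).im / 2 + (∑ k ∈ weilPrimeIndex a, (Λ k : ℝ) / Real.sqrt k * Real.sin (freq a m * Real.log k)) - archExpSumSin a m) / π / (m : ℝ) ^ (2 * (j : ℕ) + 1)) * (((Complex.digamma (1 / 4 + ((freq a m : ℝ) : ℂ) / 2 * I)).im / 2 + (∑ k ∈ weilPrimeIndex a, (Λ k : ℝ) / Real.sqrt k * Real.sin (freq a m * Real.log k)) - archExpSumSin a m) / π / (m : ℝ) ^ (2 * (j' : ℕ) + 1)) / w m) * ((-1 : ℝ) ^ (i : ℕ) * (i : ℝ) ^ (2 * (j : ℕ))) * ((-1 : ℝ) ^ (i' : ℕ) * (i'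 : ℝ) ^ (2 * (j' : ℕ))))
            + ∑ j : Fin J, ∑ r' : Fin J, (∑ m ∈ Finset.Ico B₃ B₄, (((Complex.digamma (1 / 4 + ((freq a m : ℝ) : ℂ) / 2 * I)).im / 2 + (∑ k ∈ weilPrimeIndex a, (Λ k : ℝ) / Real.sqrt k * Real.sin (freq a m * Real.log k)) - archExpSumSin a m) / π / (m : ℝ) ^ (2 * (j : ℕ) + 1)) * (1 / (m : ℝ) ^ (2 * (r' : ℕ) + 2)) / w m) * ((-1 : ℝ) ^ (i : ℕ) * (i : ℝ) ^ (2 * (j : ℕ))) * ((-1 : ℝ) ^ (i' : ℕ) * (-((i' : ℝ) ^ (2 * (r' : ℕ) + 1)) * ((Complex.digamma (1 / 4 + ((freq a i' : ℝ) : ℂ) / 2 * I)).im / 2 + (∑ k ∈ weilPrimeIndex a, (Λ k : ℝ) / Real.sqrt k * Real.sin (freq a i' * Real.log k)) - archExpSumSin a i') / π + 4 / a * (Real.exp (a / 2) - Real.exp (-(a / 2))) ^ 2 * (-1 : ℝ) ^ (r' : ℕ) * (a ^ 2 / (4 * π ^ 2)) ^ ((r' : ℕ) + 1) * (1 / (1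 + 4 * freq a i' ^ 2)))))
          + ((∑ r' : Fin J, ∑ j : Fin J, (∑ m ∈ Finset.Ico B₃ B₄, (1 / (m : ℝ) ^ (2 * (r' : ℕ) + 2)) * (((Complex.digamma (1 / 4 + ((freq a m : ℝ) : ℂ) / 2 * I)).im / 2 + (∑ k ∈ weilPrimeIndex a, (Λ k : ℝ) / Real.sqrt k * Real.sin (freq a m * Real.log k)) - archExpSumSin a m) / π / (m : ℝ) ^ (2 * (j : ℕ) + 1)) / w m) * ((-1 : ℝ) ^ (i : ℕ) * (-((i : ℝ) ^ (2 * (r' : ℕ) + 1)) * ((Complex.digamma (1 / 4 + ((freq a i : ℝ) : ℂ) / 2 * I)).im / 2 + (∑ k ∈ weilPrimeIndex a, (Λ k : ℝ) / Real.sqrt k * Real.sin (freq a i * Real.log k)) - archExpSumSin a i) / π + 4 / a * (Real.exp (a / 2) - Real.exp (-(a / 2))) ^ 2 * (-1 : ℝ) ^ (r' : ℕ) * (a ^ 2 / (4 * π ^ 2)) ^ ((r' : ℕ) + 1) * (1 / (1 + 4 * freq a i ^ 2)))) * ((-1 : ℝ) ^ (i' : ℕ) * (i' : ℝ) ^ (2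 * (j : ℕ))))
            + ∑ r' : Fin J, ∑ r'' : Fin J, (∑ m ∈ Finset.Ico B₃ B₄, (1 / (m : ℝ) ^ (2 * (r' : ℕ) + 2)) * (1 / (m : ℝ) ^ (2 * (r'' : ℕ) + 2)) / w m) * ((-1 : ℝ) ^ (i : ℕ) * (-((i : ℝ) ^ (2 * (r' : ℕ) + 1)) * ((Complex.digamma (1 / 4 + ((freq a i : ℝ) : ℂ) / 2 * I)).im / 2 + (∑ k ∈ weilPrimeIndex a, (Λ k : ℝ) / Real.sqrt k * Real.sin (freq a i * Real.log k)) - archExpSumSin a i) / π + 4 / a * (Real.exp (a / 2) - Real.exp (-(a / 2))) ^ 2 * (-1 : ℝ) ^ (r' : ℕ) * (a ^ 2 / (4 * π ^ 2)) ^ ((r' : ℕ) + 1) * (1 / (1 + 4 * freq a i ^ 2)))) * ((-1 : ℝ) ^ (i' : ℕ) * (-((i' : ℝ) ^ (2 * (r'' : ℕ) + 1)) * ((Complex.digamma (1 / 4 + ((freq a i' : ℝ) : ℂ) / 2 * I)).im / 2 + (∑ k ∈ weilPrimeIndex a, (Λ k : ℝ) / Real.sqrt k * Real.sin (freq a i'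 * Real.log k)) - archExpSumSin a i') / π + 4 / a * (Real.exp (a / 2) - Real.exp (-(a / 2))) ^ 2 * (-1 : ℝ) ^ (r'' : ℕ) * (a ^ 2 / (4 * π ^ 2)) ^ ((r'' : ℕ) + 1) * (1 / (1 + 4 * freq a i' ^ 2))))))
        + (if i = i' then (1 + θ⁻¹) * (B : ℝ) * ((2 * (π / 4 + (∑ k ∈ weilPrimeIndex a, (Λ k : ℝ) / Real.sqrt k) + a * (1 + weilArchDensity (2 * a)) / π) * (i : ℝ) ^ (2 * J) / π + 4 / a * (Real.exp (a / 2) - Real.exp (-(a / 2))) ^ 2 * (a ^ 2 / (4 * π ^ 2)) ^ (J + 1) * (1 / (1 + 4 * freq a i ^ 2)))) ^ 2 * (∑ m ∈ Finset.Ico B₃ B₄, (1 / ((m : ℝ) ^ (2 * J + 1))) ^ 2 / w m) else 0))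
      = UmidEvenJ a θ B B₃ B₄ J w i i' := by
  unfold UmidEvenJ
  simp only [Finset.sum_range, Fin.val_inj]

/-- **Compressed exact middle, odd sector** (kernel indices `k, k' : ℕ` = modes `k+1, k'+1`; columns `l ↦` mode `l+1`).
[cite: Yoshida1992HermitianForms, §7 pp. 305–312] -/
noncomputable def UmidOddJ (a θ : ℝ) (B B₃ B₄ J : ℕ) (w : ℕ → ℝ) (k k' : ℕ) : ℝ :=
  (1 + θ) * (((∑ j ∈ Finset.range J, ∑ j' ∈ Finset.range J, (∑ l ∈ Finset.Ico B₃ B₄, (((Complex.digamma (1 / 4 + ((freq a ((l : ℤ) + 1) : ℝ) : ℂ) / 2 * I)).im / 2 + (∑ k ∈ weilPrimeIndex a, (Λ k : ℝ) / Real.sqrt k * Real.sin (freq a ((l : ℤ) + 1) * Real.log k)) - archExpSumSin a ((l : ℤ) + 1)) / π / ((l : ℝ) + 1) ^ (2 * j + 2)) * (((Complex.digamma (1 / 4 + ((freq a ((l : ℤ) + 1) : ℝ) : ℂ) / 2 * I)).im / 2 + (∑ k ∈ weilPrimeIndex a, (Λ k : ℝ) / Real.sqrt k * Real.sin (freq a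 ((l : ℤ) + 1) * Real.log k)) - archExpSumSin a ((l : ℤ) + 1)) / π / ((l : ℝ) + 1) ^ (2 * j' + 2)) / w l) * ((-1 : ℝ) ^ (k + 1) * ((k : ℝ) + 1) ^ (2 * j + 1)) * ((-1 : ℝ) ^ (k' + 1) * ((k' : ℝ) + 1) ^ (2 * j' + 1)))
            + ∑ j ∈ Finset.range J, ∑ r' ∈ Finset.range J, (∑ l ∈ Finset.Ico B₃ B₄, (((Complex.digamma (1 / 4 + ((freq a ((l : ℤ) + 1) : ℝ) : ℂ) / 2 * I)).im / 2 + (∑ k ∈ weilPrimeIndex a, (Λ k : ℝ) / Real.sqrt k * Real.sin (freq a ((l : ℤ) + 1) * Real.log k)) - archExpSumSin a ((l : ℤ) + 1)) / π / ((l : ℝ) + 1) ^ (2 * j + 2)) * (1 / ((l : ℝ) + 1) ^ (2 * r' + 1)) / w l) * ((-1 : ℝ) ^ (k + 1) * ((k : ℝ) + 1) ^ (2 * j + 1)) * ((-1 : ℝ) ^ (k' + 1) * (-(((k' : ℝ) + 1) ^ (2 * r')) * ((Complex.digamma (1 / 4 + ((freq a ((k' : ℤ) + 1) : ℝ) : ℂ)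 / 2 * I)).im / 2 + (∑ p ∈ weilPrimeIndex a, (Λ p : ℝ) / Real.sqrt p * Real.sin (freq a ((k' : ℤ) + 1) * Real.log p)) - archExpSumSin a ((k' : ℤ) + 1)) / π - 4 * (Real.exp (a / 2) - Real.exp (-(a / 2))) ^ 2 / π * (-1 : ℝ) ^ r' * (a ^ 2 / (4 * π ^ 2)) ^ r' * (freq a ((k' : ℤ) + 1) / (1 + 4 * freq a ((k' : ℤ) + 1) ^ 2)))))
          + ((∑ r' ∈ Finset.range J, ∑ j ∈ Finset.range J, (∑ l ∈ Finset.Ico B₃ B₄, (1 / ((l : ℝ) + 1) ^ (2 * r' + 1)) * (((Complex.digamma (1 / 4 + ((freq a ((l : ℤ) + 1) : ℝ) : ℂ) / 2 * I)).im / 2 + (∑ k ∈ weilPrimeIndex a, (Λ k : ℝ) / Real.sqrt k * Real.sin (freq a ((l : ℤ) + 1) * Real.log k)) - archExpSumSin a ((l : ℤ) + 1)) / π / ((l : ℝ) + 1) ^ (2 * j + 2)) / w l) * ((-1 : ℝ) ^ (k + 1) * (-(((k : ℝ) + 1) ^ (2 * r')) * ((Complex.digamma (1 / 4 + ((freq a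 ((k : ℤ) + 1) : ℝ) : ℂ) / 2 * I)).im / 2 + (∑ p ∈ weilPrimeIndex a, (Λ p : ℝ) / Real.sqrt p * Real.sin (freq a ((k : ℤ) + 1) * Real.log p)) - archExpSumSin a ((k : ℤ) + 1)) / π - 4 * (Real.exp (a / 2) - Real.exp (-(a / 2))) ^ 2 / π * (-1 : ℝ) ^ r' * (a ^ 2 / (4 * π ^ 2)) ^ r' * (freq a ((k : ℤ) + 1) / (1 + 4 * freq a ((k : ℤ) + 1) ^ 2)))) * ((-1 : ℝ) ^ (k' + 1) * ((k' : ℝ) + 1) ^ (2 * j + 1)))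
            + ∑ r' ∈ Finset.range J, ∑ r'' ∈ Finset.range J, (∑ l ∈ Finset.Ico B₃ B₄, (1 / ((l : ℝ) + 1) ^ (2 * r' + 1)) * (1 / ((l : ℝ) + 1) ^ (2 * r'' + 1)) / w l) * ((-1 : ℝ) ^ (k + 1) * (-(((k : ℝ) + 1) ^ (2 * r')) * ((Complex.digamma (1 / 4 + ((freq a ((k : ℤ) + 1) : ℝ) : ℂ) / 2 * I)).im / 2 + (∑ p ∈ weilPrimeIndex a, (Λ p : ℝ) / Real.sqrt p * Real.sin (freq a ((k : ℤ) + 1) * Real.log p)) - archExpSumSin a ((k : ℤ) + 1)) / π - 4 * (Real.exp (a / 2) - Real.exp (-(a / 2))) ^ 2 / π * (-1 : ℝ) ^ r' * (a ^ 2 / (4 * π ^ 2)) ^ r' * (freq a ((k : ℤ) + 1) / (1 + 4 * freq a ((k : ℤ) + 1) ^ 2)))) * ((-1 : ℝ) ^ (k' + 1) * (-(((k' : ℝ) + 1) ^ (2 * r'')) * ((Complex.digamma (1 / 4 + ((freq a ((k' : ℤ) + 1) : ℝ) : ℂ) / 2 * I)).im / 2 + (∑ p ∈ weilPrimeIndex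 a, (Λ p : ℝ) / Real.sqrt p * Real.sin (freq a ((k' : ℤ) + 1) * Real.log p)) - archExpSumSin a ((k' : ℤ) + 1)) / π - 4 * (Real.exp (a / 2) - Real.exp (-(a / 2))) ^ 2 / π * (-1 : ℝ) ^ r'' * (a ^ 2 / (4 * π ^ 2)) ^ r'' * (freq a ((k' : ℤ) + 1) / (1 + 4 * freq a ((k' : ℤ) + 1) ^ 2))))))
        + (if k = k' then (1 + θ⁻¹) * (B : ℝ) * ((2 * (π / 4 + (∑ k ∈ weilPrimeIndex a, (Λ k : ℝ) / Real.sqrt k) + a * (1 + weilArchDensity (2 * a)) / π) * ((k : ℝ) + 1) ^ (2 * J) / π + 4 * (Real.exp (a / 2) - Real.exp (-(a / 2))) ^ 2 / π * (a ^ 2 / (4 * π ^ 2)) ^ J * (freq a ((k : ℤ) + 1) / (1 + 4 * freq a ((k : ℤ) + 1) ^ 2)))) ^ 2 * (∑ l ∈ Finset.Ico B₃ B₄, (1 / (((l : ℝ) + 1) ^ (2 * J + 1))) ^ 2 / w l) else 0)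

/-- **Bridge**: the door's inline odd middle matrix is `UmidOddJ`. [cite: Yoshida1992HermitianForms, §7 pp. 305–312] -/
theorem UmidOddJ_fin (a θ : ℝ) {B : ℕ} (B₃ B₄ J : ℕ) (w : ℕ → ℝ) (k k' : Fin B) :
    ((1 + θ) * (((∑ j : Fin J, ∑ j' : Fin J, (∑ l ∈ Finset.Ico B₃ B₄, (((Complex.digamma (1 / 4 + ((freq a ((l : ℤ) + 1) : ℝ) : ℂ) / 2 * I)).im / 2 + (∑ k ∈ weilPrimeIndex a, (Λ k : ℝ) / Real.sqrt k * Real.sin (freq a ((l : ℤ) + 1) * Real.log k)) - archExpSumSin a ((l : ℤ) + 1)) / π / ((l : ℝ) + 1) ^ (2 * (j : ℕ) + 2)) * (((Complex.digamma (1 / 4 + ((freq a ((l : ℤ) + 1) : ℝ) : ℂ) / 2 * I)).im / 2 + (∑ k ∈ weilPrimeIndex a, (Λ k : ℝ) / Real.sqrt k * Real.sin (freq a ((l : ℤ) + 1) * Real.log k)) - archExpSumSin a ((l : ℤ) + 1)) / π / ((l : ℝ) + 1) ^ (2 * (j' : ℕ) + 2)) / w l) * ((-1 : ℝ) ^ ((k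 : ℕ) + 1) * (((k : ℕ) : ℝ) + 1) ^ (2 * (j : ℕ) + 1)) * ((-1 : ℝ) ^ ((k' : ℕ) + 1) * (((k' : ℕ) : ℝ) + 1) ^ (2 * (j' : ℕ) + 1)))
            + ∑ j : Fin J, ∑ r' : Fin J, (∑ l ∈ Finset.Ico B₃ B₄, (((Complex.digamma (1 / 4 + ((freq a ((l : ℤ) + 1) : ℝ) : ℂ) / 2 * I)).im / 2 + (∑ k ∈ weilPrimeIndex a, (Λ k : ℝ) / Real.sqrt k * Real.sin (freq a ((l : ℤ) + 1) * Real.log k)) - archExpSumSin a ((l : ℤ) + 1)) / π / ((l : ℝ) + 1) ^ (2 * (j : ℕ) + 2)) * (1 / ((l : ℝ) + 1) ^ (2 * (r' : ℕ) + 1)) / w l) * ((-1 : ℝ) ^ ((k : ℕ) + 1) * (((k : ℕ) : ℝ) + 1) ^ (2 * (j : ℕ) + 1)) * ((-1 : ℝ) ^ ((k' : ℕ) + 1) * (-((((k' : ℕ) : ℝ) + 1) ^ (2 * (r' : ℕ))) * ((Complex.digamma (1 / 4 + ((freq a (((k' : ℕ) : ℤ) + 1) : ℝ) : ℂ) / 2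 * I)).im / 2 + (∑ p ∈ weilPrimeIndex a, (Λ p : ℝ) / Real.sqrt p * Real.sin (freq a (((k' : ℕ) : ℤ) + 1) * Real.log p)) - archExpSumSin a (((k' : ℕ) : ℤ) + 1)) / π - 4 * (Real.exp (a / 2) - Real.exp (-(a / 2))) ^ 2 / π * (-1 : ℝ) ^ (r' : ℕ) * (a ^ 2 / (4 * π ^ 2)) ^ (r' : ℕ) * (freq a (((k' : ℕ) : ℤ) + 1) / (1 + 4 * freq a (((k' : ℕ) : ℤ) + 1) ^ 2)))))
          + ((∑ r' : Fin J, ∑ j : Fin J, (∑ l ∈ Finset.Ico B₃ B₄, (1 / ((l : ℝ) + 1) ^ (2 * (r' : ℕ) + 1)) * (((Complex.digamma (1 / 4 + ((freq a ((l : ℤ) + 1) : ℝ) : ℂ) / 2 * I)).im / 2 + (∑ k ∈ weilPrimeIndex a, (Λ k : ℝ) / Real.sqrt k * Real.sin (freq a ((l : ℤ) + 1) * Real.log k)) - archExpSumSin a ((l : ℤ) + 1)) / π / ((l : ℝ) + 1) ^ (2 * (j : ℕ) + 2)) / w l) * ((-1 : ℝ) ^ ((k : ℕ) + 1) * (-((((k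 : ℕ) : ℝ) + 1) ^ (2 * (r' : ℕ))) * ((Complex.digamma (1 / 4 + ((freq a (((k : ℕ) : ℤ) + 1) : ℝ) : ℂ) / 2 * I)).im / 2 + (∑ p ∈ weilPrimeIndex a, (Λ p : ℝ) / Real.sqrt p * Real.sin (freq a (((k : ℕ) : ℤ) + 1) * Real.log p)) - archExpSumSin a (((k : ℕ) : ℤ) + 1)) / π - 4 * (Real.exp (a / 2) - Real.exp (-(a / 2))) ^ 2 / π * (-1 : ℝ) ^ (r' : ℕ) * (a ^ 2 / (4 * π ^ 2)) ^ (r' : ℕ) * (freq a (((k : ℕ) : ℤ) + 1) / (1 + 4 * freq a (((k : ℕ) : ℤ) + 1) ^ 2)))) * ((-1 : ℝ) ^ ((k' : ℕ) + 1) * (((k' : ℕ) : ℝ) + 1) ^ (2 * (j : ℕ) + 1)))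
            + ∑ r' : Fin J, ∑ r'' : Fin J, (∑ l ∈ Finset.Ico B₃ B₄, (1 / ((l : ℝ) + 1) ^ (2 * (r' : ℕ) + 1)) * (1 / ((l : ℝ) + 1) ^ (2 * (r'' : ℕ) + 1)) / w l) * ((-1 : ℝ) ^ ((k : ℕ) + 1) * (-((((k : ℕ) : ℝ) + 1) ^ (2 * (r' : ℕ))) * ((Complex.digamma (1 / 4 + ((freq a (((k : ℕ) : ℤ) + 1) : ℝ) : ℂ) / 2 * I)).im / 2 + (∑ p ∈ weilPrimeIndex a, (Λ p : ℝ) / Real.sqrt p * Real.sin (freq a (((k : ℕ) : ℤ) + 1) * Real.log p)) - archExpSumSin a (((k : ℕ) : ℤ) + 1)) / π - 4 * (Real.exp (a / 2) - Real.exp (-(a / 2))) ^ 2 / π * (-1 : ℝ) ^ (r' : ℕ) * (a ^ 2 / (4 * π ^ 2)) ^ (r' : ℕ) * (freq a (((k : ℕ) : ℤ) + 1) / (1 + 4 * freq a (((k : ℕ) : ℤ) + 1) ^ 2)))) * ((-1 : ℝ) ^ ((k' : ℕ) + 1) * (-((((k' : ℕ) : ℝ) + 1) ^ (2 * (r'' :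 ℕ))) * ((Complex.digamma (1 / 4 + ((freq a (((k' : ℕ) : ℤ) + 1) : ℝ) : ℂ) / 2 * I)).im / 2 + (∑ p ∈ weilPrimeIndex a, (Λ p : ℝ) / Real.sqrt p * Real.sin (freq a (((k' : ℕ) : ℤ) + 1) * Real.log p)) - archExpSumSin a (((k' : ℕ) : ℤ) + 1)) / π - 4 * (Real.exp (a / 2) - Real.exp (-(a / 2))) ^ 2 / π * (-1 : ℝ) ^ (r'' : ℕ) * (a ^ 2 / (4 * π ^ 2)) ^ (r'' : ℕ) * (freq a (((k' : ℕ) : ℤ) + 1) / (1 + 4 * freq a (((k' : ℕ) : ℤ) + 1) ^ 2))))))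
        + (if k = k' then (1 + θ⁻¹) * (B : ℝ) * ((2 * (π / 4 + (∑ k ∈ weilPrimeIndex a, (Λ k : ℝ) / Real.sqrt k) + a * (1 + weilArchDensity (2 * a)) / π) * (((k : ℕ) : ℝ) + 1) ^ (2 * J) / π + 4 * (Real.exp (a / 2) - Real.exp (-(a / 2))) ^ 2 / π * (a ^ 2 / (4 * π ^ 2)) ^ J * (freq a (((k : ℕ) : ℤ) + 1) / (1 + 4 * freq a (((k : ℕ) : ℤ) + 1) ^ 2)))) ^ 2 * (∑ l ∈ Finset.Ico B₃ B₄, (1 / (((l : ℝ) + 1) ^ (2 * J + 1))) ^ 2 / w l) else 0))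
      = UmidOddJ a θ B B₃ B₄ J w k k' := by
  unfold UmidOddJ
  simp only [Finset.sum_range, Fin.val_inj]


/-! ## Even sector: Gram blocks, structured and factored forms -/

/-- Middle Gram block `AA`: `Σ_{m∈[B₃,B₄)} (F_m/(π m^{2j+1}))(F_m/(π m^{2j'+1}))/w_m`.
[cite: Yoshida1992HermitianForms, §7 pp. 305–312] -/
noncomputable def hmAAe (a : ℝ) (w : ℕ → ℝ) (B₃ B₄ j j' : ℕ) : ℝ :=
  ∑ m ∈ Finset.Ico B₃ B₄, (modeF a m / π / (m : ℝ) ^ (2 * j + 1)) * (modeF a m / π / (m : ℝ) ^ (2 * j' + 1)) / w m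

/-- Middle Gram block `AB`. [cite: Yoshida1992HermitianForms, §7 pp. 305–312] -/
noncomputable def hmABe (a : ℝ) (w : ℕ → ℝ) (B₃ B₄ j r' : ℕ) : ℝ :=
  ∑ m ∈ Finset.Ico B₃ B₄, (modeF a m / π / (m : ℝ) ^ (2 * j + 1)) * (1 / (m : ℝ) ^ (2 * r' + 2)) / w m

/-- Middle Gram block `BA`. [cite: Yoshida1992HermitianForms, §7 pp. 305–312] -/
noncomputable def hmBAe (a : ℝ) (w : ℕ → ℝ) (B₃ B₄ r' j : ℕ) : ℝ :=
  ∑ m ∈ Finset.Ico B₃ B₄, (1 / (m : ℝ) ^ (2 * r' + 2)) * (modeF a m / π / (m : ℝ) ^ (2 * j + 1)) / w m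

/-- Middle Gram block `BB`. [cite: Yoshida1992HermitianForms, §7 pp. 305–312] -/
noncomputable def hmBBe (w : ℕ → ℝ) (B₃ B₄ r' r'' : ℕ) : ℝ :=
  ∑ m ∈ Finset.Ico B₃ B₄, (1 / (m : ℝ) ^ (2 * r' + 2)) * (1 / (m : ℝ) ^ (2 * r'' + 2)) / w m

/-- Middle remainder moment `Σ_m (m^{−(2J+1)})²/w_m`. [cite: Yoshida1992HermitianForms, §7 pp. 305–312] -/
noncomputable def smidE (w : ℕ → ℝ) (B₃ B₄ J : ℕ) : ℝ :=
  ∑ m ∈ Finset.Ico B₃ B₄, (1 / ((m : ℝ) ^ (2 * J + 1))) ^ 2 / w m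

/-- Structured even middle matrix. [cite: Yoshida1992HermitianForms, §7 pp. 305–312] -/
noncomputable def UmidEvenJ' (a θ : ℝ) (B B₃ B₄ J : ℕ) (w : ℕ → ℝ) (i i' : ℕ) : ℝ :=
  (1 + θ) * (((∑ j ∈ Finset.range J, ∑ j' ∈ Finset.range J, hmAAe a w B₃ B₄ j j' * vAe i j * vAe i' j')
            + ∑ j ∈ Finset.range J, ∑ r' ∈ Finset.range J, hmABe a w B₃ B₄ j r' * vAe i j * vBe a i' r')
          + ((∑ r' ∈ Finset.range J, ∑ j ∈ Finset.range J, hmBAe a w B₃ B₄ r' j * vBe a i r' * vAe i' j)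
            + ∑ r' ∈ Finset.range J, ∑ r'' ∈ Finset.range J, hmBBe w B₃ B₄ r' r'' * vBe a i r' * vBe a i' r''))
        + (if i = i' then (1 + θ⁻¹) * (B : ℝ) * rhoE a J i ^ 2 * smidE w B₃ B₄ J else 0)

/-- The structured form is the verbatim one. [cite: Yoshida1992HermitianForms, §7 pp. 305–312] -/
theorem UmidEvenJ'_eq (a θ : ℝ) (B B₃ B₄ J : ℕ) (w : ℕ → ℝ) (i i' : ℕ) :
    UmidEvenJ' a θ B B₃ B₄ J w i i' = UmidEvenJ a θ B B₃ B₄ J w i i' := by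
  simp only [UmidEvenJ', UmidEvenJ, hmAAe, hmABe, hmBAe, hmBBe, smidE, vAe, vBe, rhoE, cF, qq, s2r, ccoef, modeF,
    primeMass]

/-- Right factors of the factored middle (even): `(1+θ)·((H^{AA}v^A(i'))_r + (H^{AB}v^B(i'))_r)` for `r < J`,
`(1+θ)·((H^{BA}v^A(i'))_{r−J} + (H^{BB}v^B(i'))_{r−J})` for `J ≤ r`. [cite: Yoshida1992HermitianForms, §7 pp. 305–312] -/
noncomputable def psiMidE (a θ : ℝ) (B₃ B₄ J : ℕ) (w : ℕ → ℝ) (i' r : ℕ) : ℝ :=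
  if r < J then
    (1 + θ) * ((∑ j' ∈ Finset.range J, hmAAe a w B₃ B₄ r j' * vAe i' j')
      + ∑ r' ∈ Finset.range J, hmABe a w B₃ B₄ r r' * vBe a i' r')
  else
    (1 + θ) * ((∑ j ∈ Finset.range J, hmBAe a w B₃ B₄ (r - J) j * vAe i' j)
      + ∑ r'' ∈ Finset.range J, hmBBe w B₃ B₄ (r - J) r'' * vBe a i' r'')

/-- Diagonal of the factored middle (even). [cite: Yoshida1992HermitianForms, §7 pp. 305–312] -/
noncomputable def dMidE (a θ : ℝ) (B B₃ B₄ J : ℕ) (w : ℕ → ℝ) (i : ℕ) : ℝ :=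
  (1 + θ⁻¹) * (B : ℝ) * rhoE a J i ^ 2 * smidE w B₃ B₄ J

/-- **`U_mid⁺ = Σ_{r<2J} φ_r ψ_rᵀ + diag`** with the order-`J` left factors `phiJe`.
[cite: Yoshida1992HermitianForms, §7 pp. 305–312] -/
theorem UmidEvenJ_eq_factored (a θ : ℝ) (B B₃ B₄ J : ℕ) (w : ℕ → ℝ) (i i' : ℕ) :
    UmidEvenJ a θ B B₃ B₄ J w i i'
      = (∑ r ∈ Finset.range (J + J), phiJe a J i r * psiMidE a θ B₃ B₄ J w i' r)
        + (if i = i' then dMidE a θ B B₃ B₄ J w i else 0) := by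
  rw [← UmidEvenJ'_eq, Finset.sum_range_add]
  unfold UmidEvenJ' phiJe psiMidE dMidE
  have hA : ∀ r ∈ Finset.range J, (if r < J then vAe i r else vBe a i (r - J)) *
      (if r < J then (1 + θ) * ((∑ j' ∈ Finset.range J, hmAAe a w B₃ B₄ r j' * vAe i' j')
          + ∑ r' ∈ Finset.range J, hmABe a w B₃ B₄ r r' * vBe a i' r')
        else (1 + θ) * ((∑ j ∈ Finset.range J, hmBAe a w B₃ B₄ (r - J) j * vAe i' j)
          + ∑ r'' ∈ Finset.range J, hmBBe w B₃ B₄ (r - J) r'' * vBe a i' r''))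
      = (1 + θ) * ((∑ j' ∈ Finset.range J, hmAAe a w B₃ B₄ r j' * vAe i r * vAe i' j')
          + ∑ r' ∈ Finset.range J, hmABe a w B₃ B₄ r r' * vAe i r * vBe a i' r') := by
    intro r hr
    rw [if_pos (Finset.mem_range.mp hr), if_pos (Finset.mem_range.mp hr)]
    simp only [mul_add, Finset.mul_sum]
    congr 1 <;> exact Finset.sum_congr rfl fun _ _ ↦ by ring
  have hB : ∀ r ∈ Finset.range J, (if J + r < J then vAe i (J + r) else vBe a i (J + r - J)) *
      (if J + r < J then (1 + θ) * ((∑ j' ∈ Finset.range J, hmAAe a w B₃ B₄ (J + r) j' * vAe i' j')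
          + ∑ r' ∈ Finset.range J, hmABe a w B₃ B₄ (J + r) r' * vBe a i' r')
        else (1 + θ) * ((∑ j ∈ Finset.range J, hmBAe a w B₃ B₄ (J + r - J) j * vAe i' j)
          + ∑ r'' ∈ Finset.range J, hmBBe w B₃ B₄ (J + r - J) r'' * vBe a i' r''))
      = (1 + θ) * ((∑ j ∈ Finset.range J, hmBAe a w B₃ B₄ r j * vBe a i r * vAe i' j)
          + ∑ r'' ∈ Finset.range J, hmBBe w B₃ B₄ r r'' * vBe a i r * vBe a i' r'') := by
    intro r _
    rw [if_neg (by omega), if_neg (by omega), Nat.add_sub_cancel_left]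
    simp only [mul_add, Finset.mul_sum]
    congr 1 <;> exact Finset.sum_congr rfl fun _ _ ↦ by ring
  rw [Finset.sum_congr rfl hA, Finset.sum_congr rfl hB, ← Finset.mul_sum, ← Finset.mul_sum, Finset.sum_add_distrib,
    Finset.sum_add_distrib, ← mul_add]

/-- `ψ·B^{p(r)}` (even middle). [cite: Yoshida1992HermitianForms, §7 pp. 305–312] -/
noncomputable def psiMidES (a θ : ℝ) (B B₃ B₄ J : ℕ) (w : ℕ → ℝ) (i' r : ℕ) : ℝ :=
  psiMidE a θ B₃ B₄ J w i' r * (B : ℝ) ^ pJe J r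

/-- **`U_mid⁺ = Σ_{r<2J} (φ_r/λ_r)(ψ_r λ_r)ᵀ + diag`** (`B > 0`). [cite: Yoshida1992HermitianForms, §7 pp. 305–312] -/
theorem UmidEvenJ_eq_factoredS (a θ : ℝ) {B : ℕ} (hB : 0 < B) (B₃ B₄ J : ℕ) (w : ℕ → ℝ) (i i' : ℕ) :
    UmidEvenJ a θ B B₃ B₄ J w i i'
      = (∑ r ∈ Finset.range (J + J), phiJeS a B J i r * psiMidES a θ B B₃ B₄ J w i' r)
        + (if i = i' then dMidE a θ B B₃ B₄ J w i else 0) := by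
  rw [UmidEvenJ_eq_factored]
  congr 1
  refine Finset.sum_congr rfl fun r _ ↦ ?_
  unfold phiJeS psiMidES
  have hBp : ((B : ℝ)) ^ pJe J r ≠ 0 := pow_ne_zero _ (by exact_mod_cast hB.ne')
  field_simp

/-- `hmAAe` is symmetric. [cite: Yoshida1992HermitianForms, §7 pp. 305–312] -/
theorem hmAAe_comm (a : ℝ) (w : ℕ → ℝ) (B₃ B₄ j j' : ℕ) : hmAAe a w B₃ B₄ j j' = hmAAe a w B₃ B₄ j' j := by
  unfold hmAAe; exact Finset.sum_congr rfl fun _ _ ↦ by ring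

/-- `hmBBe` is symmetric. [cite: Yoshida1992HermitianForms, §7 pp. 305–312] -/
theorem hmBBe_comm (w : ℕ → ℝ) (B₃ B₄ r r' : ℕ) : hmBBe w B₃ B₄ r r' = hmBBe w B₃ B₄ r' r := by
  unfold hmBBe; exact Finset.sum_congr rfl fun _ _ ↦ by ring

/-- `hmBAe = hmABeᵀ`. [cite: Yoshida1992HermitianForms, §7 pp. 305–312] -/
theorem hmBAe_eq (a : ℝ) (w : ℕ → ℝ) (B₃ B₄ r' j : ℕ) : hmBAe a w B₃ B₄ r' j = hmABe a w B₃ B₄ j r' := by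
  unfold hmBAe hmABe; exact Finset.sum_congr rfl fun _ _ ↦ by ring

/-- `U_mid⁺(i,i') = U_mid⁺(i',i)`. [cite: Yoshida1992HermitianForms, §7 pp. 305–312] -/
theorem UmidEvenJ_comm (a θ : ℝ) (B B₃ B₄ J : ℕ) (w : ℕ → ℝ) (i i' : ℕ) :
    UmidEvenJ a θ B B₃ B₄ J w i i' = UmidEvenJ a θ B B₃ B₄ J w i' i := by
  rw [← UmidEvenJ'_eq, ← UmidEvenJ'_eq]
  unfold UmidEvenJ'
  have hAA : ∑ j ∈ Finset.range J, ∑ j' ∈ Finset.range J, hmAAe a w B₃ B₄ j j' * vAe i j * vAe i' j'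
      = ∑ j ∈ Finset.range J, ∑ j' ∈ Finset.range J, hmAAe a w B₃ B₄ j j' * vAe i' j * vAe i j' := by
    rw [Finset.sum_comm]
    refine Finset.sum_congr rfl fun j _ ↦ Finset.sum_congr rfl fun j' _ ↦ ?_
    rw [hmAAe_comm a w B₃ B₄ j' j]; ring
  have hBB : ∑ r' ∈ Finset.range J, ∑ r'' ∈ Finset.range J, hmBBe w B₃ B₄ r' r'' * vBe a i r' * vBe a i' r''
      = ∑ r' ∈ Finset.range J, ∑ r'' ∈ Finset.range J, hmBBe w B₃ B₄ r' r'' * vBe a i' r' * vBe a i r'' := by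
    rw [Finset.sum_comm]
    refine Finset.sum_congr rfl fun r' _ ↦ Finset.sum_congr rfl fun r'' _ ↦ ?_
    rw [hmBBe_comm w B₃ B₄ r'' r']; ring
  have hAB : ∑ j ∈ Finset.range J, ∑ r' ∈ Finset.range J, hmABe a w B₃ B₄ j r' * vAe i j * vBe a i' r'
      = ∑ r' ∈ Finset.range J, ∑ j ∈ Finset.range J, hmBAe a w B₃ B₄ r' j * vBe a i' r' * vAe i j := by
    rw [Finset.sum_comm]
    refine Finset.sum_congr rfl fun r' _ ↦ Finset.sum_congr rfl fun j _ ↦ ?_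
    rw [hmBAe_eq]; ring
  have hBA : ∑ r' ∈ Finset.range J, ∑ j ∈ Finset.range J, hmBAe a w B₃ B₄ r' j * vBe a i r' * vAe i' j
      = ∑ j ∈ Finset.range J, ∑ r' ∈ Finset.range J, hmABe a w B₃ B₄ j r' * vAe i' j * vBe a i r' := by
    rw [Finset.sum_comm]
    refine Finset.sum_congr rfl fun j _ ↦ Finset.sum_congr rfl fun r' _ ↦ ?_
    rw [hmBAe_eq]; ring
  rw [hAA, hBB, hAB, hBA]
  by_cases hii : i = i'
  · subst hii; ring
  · rw [if_neg hii, if_neg (Ne.symm hii)]; ring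

/-! ## Odd sector: Gram blocks, structured and factored forms -/

/-- Middle Gram block `AA`: `Σ_{l∈[B₃,B₄)} (F_{l+1}/(π (l+1)^{2j+2}))(F_{l+1}/(π (l+1)^{2j'+2}))/w_l` (column `l` = mode `l+1`).
[cite: Yoshida1992HermitianForms, §7 pp. 305–312] -/
noncomputable def hmAAo (a : ℝ) (w : ℕ → ℝ) (B₃ B₄ j j' : ℕ) : ℝ :=
  ∑ l ∈ Finset.Ico B₃ B₄, (modeF a ((l : ℤ) + 1) / π / ((l : ℝ) + 1) ^ (2 * j + 2)) * (modeF a ((l : ℤ) + 1) / π / ((l : ℝ) + 1) ^ (2 * j' + 2)) / w l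

/-- Middle Gram block `AB`. [cite: Yoshida1992HermitianForms, §7 pp. 305–312] -/
noncomputable def hmABo (a : ℝ) (w : ℕ → ℝ) (B₃ B₄ j r' : ℕ) : ℝ :=
  ∑ l ∈ Finset.Ico B₃ B₄, (modeF a ((l : ℤ) + 1) / π / ((l : ℝ) + 1) ^ (2 * j + 2)) * (1 / ((l : ℝ) + 1) ^ (2 * r' + 1)) / w l

/-- Middle Gram block `BA`. [cite: Yoshida1992HermitianForms, §7 pp. 305–312] -/
noncomputable def hmBAo (a : ℝ) (w : ℕ → ℝ) (B₃ B₄ r' j : ℕ) : ℝ :=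
  ∑ l ∈ Finset.Ico B₃ B₄, (1 / ((l : ℝ) + 1) ^ (2 * r' + 1)) * (modeF a ((l : ℤ) + 1) / π / ((l : ℝ) + 1) ^ (2 * j + 2)) / w l

/-- Middle Gram block `BB`. [cite: Yoshida1992HermitianForms, §7 pp. 305–312] -/
noncomputable def hmBBo (w : ℕ → ℝ) (B₃ B₄ r' r'' : ℕ) : ℝ :=
  ∑ l ∈ Finset.Ico B₃ B₄, (1 / ((l : ℝ) + 1) ^ (2 * r' + 1)) * (1 / ((l : ℝ) + 1) ^ (2 * r'' + 1)) / w l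

/-- Middle remainder moment `Σ_l ((l+1)^{−(2J+1)})²/w_l`. [cite: Yoshida1992HermitianForms, §7 pp. 305–312] -/
noncomputable def smidO (w : ℕ → ℝ) (B₃ B₄ J : ℕ) : ℝ :=
  ∑ l ∈ Finset.Ico B₃ B₄, (1 / (((l : ℝ) + 1) ^ (2 * J + 1))) ^ 2 / w l

/-- Structured odd middle matrix. [cite: Yoshida1992HermitianForms, §7 pp. 305–312] -/
noncomputable def UmidOddJ' (a θ : ℝ) (B B₃ B₄ J : ℕ) (w : ℕ → ℝ) (i i' : ℕ) : ℝ :=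
  (1 + θ) * (((∑ j ∈ Finset.range J, ∑ j' ∈ Finset.range J, hmAAo a w B₃ B₄ j j' * vAo i j * vAo i' j')
            + ∑ j ∈ Finset.range J, ∑ r' ∈ Finset.range J, hmABo a w B₃ B₄ j r' * vAo i j * vBo a i' r')
          + ((∑ r' ∈ Finset.range J, ∑ j ∈ Finset.range J, hmBAo a w B₃ B₄ r' j * vBo a i r' * vAo i' j)
            + ∑ r' ∈ Finset.range J, ∑ r'' ∈ Finset.range J, hmBBo w B₃ B₄ r' r'' * vBo a i r' * vBo a i' r''))
        + (if i = i' then (1 + θ⁻¹) * (B : ℝ) * rhoO a J i ^ 2 * smidO w B₃ B₄ J else 0)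

/-- The structured form is the verbatim one. [cite: Yoshida1992HermitianForms, §7 pp. 305–312] -/
theorem UmidOddJ'_eq (a θ : ℝ) (B B₃ B₄ J : ℕ) (w : ℕ → ℝ) (i i' : ℕ) :
    UmidOddJ' a θ B B₃ B₄ J w i i' = UmidOddJ a θ B B₃ B₄ J w i i' := by
  simp only [UmidOddJ', UmidOddJ, hmAAo, hmABo, hmBAo, hmBBo, smidO, vAo, vBo, rhoO, cF, qq, s2r, wcoef, modeF,
    primeMass]

/-- Right factors of the factored middle (odd): `(1+θ)·((H^{AA}v^A(i'))_r + (H^{AB}v^B(i'))_r)` for `r < J`,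
`(1+θ)·((H^{BA}v^A(i'))_{r−J} + (H^{BB}v^B(i'))_{r−J})` for `J ≤ r`. [cite: Yoshida1992HermitianForms, §7 pp. 305–312] -/
noncomputable def psiMidO (a θ : ℝ) (B₃ B₄ J : ℕ) (w : ℕ → ℝ) (i' r : ℕ) : ℝ :=
  if r < J then
    (1 + θ) * ((∑ j' ∈ Finset.range J, hmAAo a w B₃ B₄ r j' * vAo i' j')
      + ∑ r' ∈ Finset.range J, hmABo a w B₃ B₄ r r' * vBo a i' r')
  else
    (1 + θ) * ((∑ j ∈ Finset.range J, hmBAo a w B₃ B₄ (r - J) j * vAo i' j)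
      + ∑ r'' ∈ Finset.range J, hmBBo w B₃ B₄ (r - J) r'' * vBo a i' r'')

/-- Diagonal of the factored middle (odd). [cite: Yoshida1992HermitianForms, §7 pp. 305–312] -/
noncomputable def dMidO (a θ : ℝ) (B B₃ B₄ J : ℕ) (w : ℕ → ℝ) (i : ℕ) : ℝ :=
  (1 + θ⁻¹) * (B : ℝ) * rhoO a J i ^ 2 * smidO w B₃ B₄ J

/-- **`U_mid⁻ = Σ_{r<2J} φ_r ψ_rᵀ + diag`** with the order-`J` left factors `phiJo`.
[cite: Yoshida1992HermitianForms, §7 pp. 305–312] -/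
theorem UmidOddJ_eq_factored (a θ : ℝ) (B B₃ B₄ J : ℕ) (w : ℕ → ℝ) (i i' : ℕ) :
    UmidOddJ a θ B B₃ B₄ J w i i'
      = (∑ r ∈ Finset.range (J + J), phiJo a J i r * psiMidO a θ B₃ B₄ J w i' r)
        + (if i = i' then dMidO a θ B B₃ B₄ J w i else 0) := by
  rw [← UmidOddJ'_eq, Finset.sum_range_add]
  unfold UmidOddJ' phiJo psiMidO dMidO
  have hA : ∀ r ∈ Finset.range J, (if r < J then vAo i r else vBo a i (r - J)) *
      (if r < J then (1 + θ) * ((∑ j' ∈ Finset.range J, hmAAo a w B₃ B₄ r j' * vAo i' j')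
          + ∑ r' ∈ Finset.range J, hmABo a w B₃ B₄ r r' * vBo a i' r')
        else (1 + θ) * ((∑ j ∈ Finset.range J, hmBAo a w B₃ B₄ (r - J) j * vAo i' j)
          + ∑ r'' ∈ Finset.range J, hmBBo w B₃ B₄ (r - J) r'' * vBo a i' r''))
      = (1 + θ) * ((∑ j' ∈ Finset.range J, hmAAo a w B₃ B₄ r j' * vAo i r * vAo i' j')
          + ∑ r' ∈ Finset.range J, hmABo a w B₃ B₄ r r' * vAo i r * vBo a i' r') := by
    intro r hr
    rw [if_pos (Finset.mem_range.mp hr), if_pos (Finset.mem_range.mp hr)]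
    simp only [mul_add, Finset.mul_sum]
    congr 1 <;> exact Finset.sum_congr rfl fun _ _ ↦ by ring
  have hB : ∀ r ∈ Finset.range J, (if J + r < J then vAo i (J + r) else vBo a i (J + r - J)) *
      (if J + r < J then (1 + θ) * ((∑ j' ∈ Finset.range J, hmAAo a w B₃ B₄ (J + r) j' * vAo i' j')
          + ∑ r' ∈ Finset.range J, hmABo a w B₃ B₄ (J + r) r' * vBo a i' r')
        else (1 + θ) * ((∑ j ∈ Finset.range J, hmBAo a w B₃ B₄ (J + r - J) j * vAo i' j)
          + ∑ r'' ∈ Finset.range J, hmBBo w B₃ B₄ (J + r - J) r'' * vBo a i' r''))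
      = (1 + θ) * ((∑ j ∈ Finset.range J, hmBAo a w B₃ B₄ r j * vBo a i r * vAo i' j)
          + ∑ r'' ∈ Finset.range J, hmBBo w B₃ B₄ r r'' * vBo a i r * vBo a i' r'') := by
    intro r _
    rw [if_neg (by omega), if_neg (by omega), Nat.add_sub_cancel_left]
    simp only [mul_add, Finset.mul_sum]
    congr 1 <;> exact Finset.sum_congr rfl fun _ _ ↦ by ring
  rw [Finset.sum_congr rfl hA, Finset.sum_congr rfl hB, ← Finset.mul_sum, ← Finset.mul_sum, Finset.sum_add_distrib,
    Finset.sum_add_distrib, ← mul_add]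

/-- `ψ·B^{p(r)}` (odd middle). [cite: Yoshida1992HermitianForms, §7 pp. 305–312] -/
noncomputable def psiMidOS (a θ : ℝ) (B B₃ B₄ J : ℕ) (w : ℕ → ℝ) (i' r : ℕ) : ℝ :=
  psiMidO a θ B₃ B₄ J w i' r * (B : ℝ) ^ pJo J r

/-- **`U_mid⁻ = Σ_{r<2J} (φ_r/λ_r)(ψ_r λ_r)ᵀ + diag`** (`B > 0`). [cite: Yoshida1992HermitianForms, §7 pp. 305–312] -/
theorem UmidOddJ_eq_factoredS (a θ : ℝ) {B : ℕ} (hB : 0 < B) (B₃ B₄ J : ℕ) (w : ℕ → ℝ) (i i' : ℕ) :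
    UmidOddJ a θ B B₃ B₄ J w i i'
      = (∑ r ∈ Finset.range (J + J), phiJoS a B J i r * psiMidOS a θ B B₃ B₄ J w i' r)
        + (if i = i' then dMidO a θ B B₃ B₄ J w i else 0) := by
  rw [UmidOddJ_eq_factored]
  congr 1
  refine Finset.sum_congr rfl fun r _ ↦ ?_
  unfold phiJoS psiMidOS
  have hBp : ((B : ℝ)) ^ pJo J r ≠ 0 := pow_ne_zero _ (by exact_mod_cast hB.ne')
  field_simp

/-- `hmAAo` is symmetric. [cite: Yoshida1992HermitianForms, §7 pp. 305–312] -/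
theorem hmAAo_comm (a : ℝ) (w : ℕ → ℝ) (B₃ B₄ j j' : ℕ) : hmAAo a w B₃ B₄ j j' = hmAAo a w B₃ B₄ j' j := by
  unfold hmAAo; exact Finset.sum_congr rfl fun _ _ ↦ by ring

/-- `hmBBo` is symmetric. [cite: Yoshida1992HermitianForms, §7 pp. 305–312] -/
theorem hmBBo_comm (w : ℕ → ℝ) (B₃ B₄ r r' : ℕ) : hmBBo w B₃ B₄ r r' = hmBBo w B₃ B₄ r' r := by
  unfold hmBBo; exact Finset.sum_congr rfl fun _ _ ↦ by ring

/-- `hmBAo = hmABoᵀ`. [cite: Yoshida1992HermitianForms, §7 pp. 305–312] -/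
theorem hmBAo_eq (a : ℝ) (w : ℕ → ℝ) (B₃ B₄ r' j : ℕ) : hmBAo a w B₃ B₄ r' j = hmABo a w B₃ B₄ j r' := by
  unfold hmBAo hmABo; exact Finset.sum_congr rfl fun _ _ ↦ by ring

/-- `U_mid⁻(i,i') = U_mid⁻(i',i)`. [cite: Yoshida1992HermitianForms, §7 pp. 305–312] -/
theorem UmidOddJ_comm (a θ : ℝ) (B B₃ B₄ J : ℕ) (w : ℕ → ℝ) (i i' : ℕ) :
    UmidOddJ a θ B B₃ B₄ J w i i' = UmidOddJ a θ B B₃ B₄ J w i' i := by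
  rw [← UmidOddJ'_eq, ← UmidOddJ'_eq]
  unfold UmidOddJ'
  have hAA : ∑ j ∈ Finset.range J, ∑ j' ∈ Finset.range J, hmAAo a w B₃ B₄ j j' * vAo i j * vAo i' j'
      = ∑ j ∈ Finset.range J, ∑ j' ∈ Finset.range J, hmAAo a w B₃ B₄ j j' * vAo i' j * vAo i j' := by
    rw [Finset.sum_comm]
    refine Finset.sum_congr rfl fun j _ ↦ Finset.sum_congr rfl fun j' _ ↦ ?_
    rw [hmAAo_comm a w B₃ B₄ j' j]; ring
  have hBB : ∑ r' ∈ Finset.range J, ∑ r'' ∈ Finset.range J, hmBBo w B₃ B₄ r' r'' * vBo a i r' * vBo a i' r''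
      = ∑ r' ∈ Finset.range J, ∑ r'' ∈ Finset.range J, hmBBo w B₃ B₄ r' r'' * vBo a i' r' * vBo a i r'' := by
    rw [Finset.sum_comm]
    refine Finset.sum_congr rfl fun r' _ ↦ Finset.sum_congr rfl fun r'' _ ↦ ?_
    rw [hmBBo_comm w B₃ B₄ r'' r']; ring
  have hAB : ∑ j ∈ Finset.range J, ∑ r' ∈ Finset.range J, hmABo a w B₃ B₄ j r' * vAo i j * vBo a i' r'
      = ∑ r' ∈ Finset.range J, ∑ j ∈ Finset.range J, hmBAo a w B₃ B₄ r' j * vBo a i' r' * vAo i j := by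
    rw [Finset.sum_comm]
    refine Finset.sum_congr rfl fun r' _ ↦ Finset.sum_congr rfl fun j _ ↦ ?_
    rw [hmBAo_eq]; ring
  have hBA : ∑ r' ∈ Finset.range J, ∑ j ∈ Finset.range J, hmBAo a w B₃ B₄ r' j * vBo a i r' * vAo i' j
      = ∑ j ∈ Finset.range J, ∑ r' ∈ Finset.range J, hmABo a w B₃ B₄ j r' * vAo i' j * vBo a i r' := by
    rw [Finset.sum_comm]
    refine Finset.sum_congr rfl fun j _ ↦ Finset.sum_congr rfl fun r' _ ↦ ?_
    rw [hmBAo_eq]; ring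
  rw [hAA, hBB, hAB, hBA]
  by_cases hii : i = i'
  · subst hii; ring
  · rw [if_neg hii, if_neg (Ne.symm hii)]; ring

end Encl

end Literature.NumberTheory.LFunctions.Yoshida1992
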